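import Literature.NumberTheory.Automorphic.ShimuraCurveLocalUnitNorms
import Literature.NumberTheory.Automorphic.BrandtXi
import Literature.NumberTheory.Automorphic.BrandtModuleDictionary
import Literature.NumberTheory.Automorphic.DefiniteMaximalOrdersLeftOrderFibres
import Literature.NumberTheory.Automorphic.DefiniteOrderUnitsFinite
import Literature.NumberTheory.Automorphic.BrandtMatrixThetaSeries
import Literature.NumberTheory.Automorphic.BrandtThetaSeriesClassFunction
import Literature.NumberTheory.ModularForms.SiegelThetaMultiplierGaussSum
import Literature.NumberTheory.ModularForms.SiegelThetaMultiplierCyclotomic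
import Literature.NumberTheory.EllipticCurves.ModularFormsGamma0Genus
import Mathlib.NumberTheory.ModularForms.CuspFormSubmodule
import Mathlib.LinearAlgebra.Matrix.ToLin
import Literature.NumberTheory.Automorphic.BrandtSetupAdmissible
import HarnessLib
import Literature.NumberTheory.Automorphic.BrandtThetaSeriesHeckeAction
import Literature.NumberTheory.Automorphic.BrandtHeckeProjector
import Literature.NumberTheory.Automorphic.BrandtEigenvectorDegreeZero
import Literature.NumberTheory.Automorphic.EichlerSubidealCount
import Literature.NumberTheory.EllipticCurves.CongruenceNumber
import Literature.NumberTheory.EllipticCurves.HeckeCongruenceModulus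
import Literature.NumberTheory.EllipticCurves.NewformsMultiplicityOneProofs
import Literature.NumberTheory.EllipticCurves.NewformsHeckeProofs
import Literature.NumberTheory.EllipticCurves.NewformsRealCoefficients
import Summits.ABC.ABC.Theses.DefiniteXi
import Literature.NumberTheory.Automorphic.BrandtEigenvectorNonEisenstein
import Literature.NumberTheory.Automorphic.BrandtXiSetupIndependence
import Literature.NumberTheory.EllipticCurves.PastenSpectralDegreeProofs
import Literature.NumberTheory.EllipticCurves.PastenCongruenceModulusProofs
import Literature.NumberTheory.EllipticCurves.ModularDegreeMinimal
import Literature.NumberTheory.EllipticCurves.ModularCurveManinSemistableBridgeProofs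
import Literature.NumberTheory.EllipticCurves.SzpiroFreyConductorProofs
import Literature.NumberTheory.Automorphic.ShimuraCurveRibetTakahashiCokernelProofs
import Literature.NumberTheory.EllipticCurves.PastenValuationProductThm75MultiplicityProofs

/-!
# Xi helper 7 — the Mazur-free tail: `XiCoreDivisibility` (k3 g4 def), L1/L1′/L1″, L2 `v_p ξ ≤ v_p r_f + v_p|a_ℓ − ℓ − 1|`, L3 least prime `ℓ ∤ N ≤ C₃ N^ε`, prime-to-6 bookkeeping, and the statement `XiCongruenceComparison` (child 1♮) (k1 G11 §0–§1c)

Helper module 7/10 for the registered stub `stub_xiDegreeComparison` of the line `p6_tamagawa_split` (crux `DefiniteXi.SteinbergCore`, item stmt-ABC-15024, route `route-ABC-DefiniteXi`).  Content = lines 2212–2451, 2510–2528 of `Summits/ABC/ABC/Cruxes/SteinbergCore/STUB_IDEAS_stub_xiDegreeComparison_1_g44_XiMonoDefLight.lean` (gen-44 def-light edition of the critic monolith `STUB_PLAN_stub_xiDegreeComparison_XiMono.lean`) (the renamespaced k1 gen-11 certificate `STUB_IDEAS_stub_xiDegreeComparison_1_g11_Certificate.lean`: k1 gens 7–11, k2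 gen-4 kernel, k3 gen-4 tail — authors: stub-ideation seats k1/k2/k3), cut mechanically at declaration boundaries by the stub-critic (plan `STUB-PLAN-stub_xiDegreeComparison.md` §1).  Proofs verbatim; nothing restated.
-/

set_option linter.dupNamespace false
set_option autoImplicit false

noncomputable section

namespace Summit.ABC.ABC.Theorems.SteinbergCoreXi.StubIdeasK1G11

open scoped MatrixGroups ModularForm Matrix
open CongruenceSubgroup
open Literature.NumberTheory.EllipticCurves Literature.NumberTheory.EllipticCurves.ModularForms
open Literature.NumberTheory.Automorphic Literature.NumberTheory.Automorphic.Brandt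

/-! ## §0  The core (k3 g4 def verbatim; PROVED by `StubIdeasK1G10.xiCoreDivisibility`) -/

/-- **Core divisibility** (k3 gen-4 `ProbeExtremesG4.XiCoreDivisibility`, verbatim): in a definite
`XiSetup` of level `(N⁺, N⁻)`, for the newform `f` on `Γ₀(N⁺N⁻)` of an elliptic curve `W` whose Brandt
eigenlattice is the line `ℤφ`, every class `i` and every degree-zero `y`:
`ξ ∣ |2 w_i φ_i · ⟨φ, y⟩_w| · r_f`.  PROVED (crux dir `STUB_IDEAS_stub_xiDegreeComparison_1_g10_XiCoreComplete.lean`,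
`StubIdeasK1G10.xiCoreDivisibility`, 0 sorries) — a hypothesis `hX` below only because crux workfiles are not importable. -/
def XiCoreDivisibility : Prop :=
  ∀ (Nplus Nminus M : ℕ) [NeZero M], Nplus * Nminus = M →
    ∀ (S : XiSetup Nplus Nminus) [Fintype (ClassSet S.O)] (W : WeierstrassCurve ℚ) [W.IsElliptic]
      (f : CuspForm (Gamma0 M) 2), IsNewformOf W f →
    ∀ (φ : ClassSet S.O → ℤ), φ ≠ 0 →
      eigenLattice (Nplus * Nminus) (matrix S.O) (fun n => W.LFunction n) = ℤ ∙ φ →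
    ∀ (i : ClassSet S.O) (y : ClassSet S.O → ℤ), ∑ c, y c = 0 →
      (S.xi fun n => W.LFunction n) ∣
        (2 * (weight S.O i : ℤ) * φ i * ∑ c, (weight S.O c : ℤ) * φ c * y c).natAbs *
          congruenceNumber f

/-! ## §1a  k3 g4 L1/L1′/L1″/L4/L2 — copied verbatim (PROVED there and here) -/

/-- **k3 g4 L1 (PROVED, verbatim).** For a `w`-symmetric matrix `T` with constant column sums `s` and an eigenvector `T v = λ v`: if `m` divides every `w_i v_i − w_j v_j` and is coprime to one `w_{i₀} v_{i₀}`, then `m ∣ λ − s`. -/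
theorem dvd_sub_of_forall_dvd_weight_mul_sub_of_isCoprime {ι : Type*} [Fintype ι] {R : Type*}
    [CommRing R] (T : Matrix ι ι R) (w : ι → R) {lam s : R} {v : ι → R}
    (hsymm : ∀ i j, w i * T i j = w j * T j i) (hcol : ∀ j, ∑ i, T i j = s)
    (hv : T *ᵥ v = lam • v) {m : R} {i₀ : ι} (h0 : IsCoprime m (w i₀ * v i₀))
    (hcong : ∀ i j, m ∣ w i * v i - w j * v j) : m ∣ lam - s := by
  have heig := sum_mul_weight_mul_eq_of_mulVec_eq_smul T w hsymm hv i₀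
  have key : (lam - s) * (w i₀ * v i₀) = ∑ i, T i i₀ * (w i * v i - w i₀ * v i₀) := by
    have h1 : ∑ i, T i i₀ * (w i * v i - w i₀ * v i₀) =
        ∑ i, T i i₀ * (w i * v i) - (∑ i, T i i₀) * (w i₀ * v i₀) := by
      rw [Finset.sum_mul, ← Finset.sum_sub_distrib]
      exact Finset.sum_congr rfl fun i _ => by ring
    rw [h1, heig, hcol i₀]
    ring
  have hdvd : m ∣ (lam - s) * (w i₀ * v i₀) := by
    rw [key]
    exact Finset.dvd_sum fun i _ => Dvd.dvd.mul_left (hcong i i₀) _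
  exact h0.dvd_of_dvd_mul_right hdvd

variable {Nplus Nminus : ℕ}

/-- **k3 g4 L1′ (PROVED, verbatim).** L1 for the Brandt matrix of a `XiSetup` at a prime `ℓ ∤ N⁺N⁻` (column sums `ℓ + 1`, weights `w_c = #O_c^×/2`): `m ∣ λ(ℓ) − (ℓ + 1)`. -/
theorem XiSetup.dvd_sub_prime_add_one_of_forall_dvd_of_isCoprime (S : XiSetup Nplus Nminus)
    [Fintype (ClassSet S.O)] {lam : ℕ → ℤ} {v : ClassSet S.O → ℤ}
    (hv : v ∈ eigenLattice (Nplus * Nminus) (matrix S.O) lam) {m : ℤ} {c₀ : ClassSet S.O}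
    (hm : IsCoprime m ((weight S.O c₀ : ℤ) * v c₀))
    (hcong : ∀ c c', m ∣ (weight S.O c : ℤ) * v c - (weight S.O c' : ℤ) * v c')
    {ℓ : ℕ} (hℓ : ℓ.Prime) (hℓN : ¬ ℓ ∣ Nplus * Nminus) :
    m ∣ lam ℓ - (ℓ + 1) :=
  dvd_sub_of_forall_dvd_weight_mul_sub_of_isCoprime (matrix S.O ℓ) (fun c => (weight S.O c : ℤ))
    (fun i j => S.weight_mul_matrix_symm ℓ i j) (fun j => S.sum_matrix_prime_eq hℓ hℓN j)
    (hv ℓ hℓ hℓN) hm hcong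

/-- **k3 g4 L1″ (PROVED, verbatim).** Contrapositive of L1′ one prime power up: if `p^{e+1} ∤ λ(ℓ) − (ℓ+1)` and `p ∤ v_{c₀}` (`p ≥ 5`, so `p ∤ w_{c₀}`), some difference `w_c v_c − w_{c'} v_{c'}` is not divisible by `p^{e+1}`. -/
theorem XiSetup.exists_not_pow_dvd_weight_mul_sub (S : XiSetup Nplus Nminus)
    [Fintype (ClassSet S.O)] {lam : ℕ → ℤ} {v : ClassSet S.O → ℤ}
    (hv : v ∈ eigenLattice (Nplus * Nminus) (matrix S.O) lam) {p : ℕ} (hp : p.Prime)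
    (h5 : 5 ≤ p) {c₀ : ClassSet S.O} (hv0 : ¬ (p : ℤ) ∣ v c₀)
    {ℓ : ℕ} (hℓ : ℓ.Prime) (hℓN : ¬ ℓ ∣ Nplus * Nminus) {e : ℕ}
    (hne : ¬ (p : ℤ) ^ (e + 1) ∣ lam ℓ - (ℓ + 1)) :
    ∃ c c' : ClassSet S.O,
      ¬ (p : ℤ) ^ (e + 1) ∣ (weight S.O c : ℤ) * v c - (weight S.O c' : ℤ) * v c' := by
  by_contra h
  push Not at h
  have hpZ : Prime (p : ℤ) := Nat.prime_iff_prime_int.mp hp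
  have hw0 : ¬ (p : ℤ) ∣ (weight S.O c₀ : ℤ) * v c₀ := by
    intro hd
    rcases hpZ.dvd_or_dvd hd with h1 | h1
    · exact S.not_dvd_weight c₀ hp h5 (Int.natCast_dvd_natCast.mp h1)
    · exact hv0 h1
  have hcop : IsCoprime ((p : ℤ) ^ (e + 1)) ((weight S.O c₀ : ℤ) * v c₀) :=
    ((Prime.coprime_iff_not_dvd hpZ).mpr hw0).pow_left
  exact hne (XiSetup.dvd_sub_prime_add_one_of_forall_dvd_of_isCoprime S hv hcop h hℓ hℓN)

/-- L4 (PROVED): `|a_ℓ(W) − (ℓ+1)| ≤ 4ℓ`. -/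
theorem natAbs_lFunction_sub_le (W : WeierstrassCurve ℚ) [W.IsElliptic] {ℓ : ℕ} (hℓ : ℓ.Prime) :
    (((W.LFunction ℓ - (ℓ + 1)).natAbs : ℕ) : ℝ) ≤ 4 * ℓ := by
  have hb := W.abs_LFunction_prime_pow_le hℓ 1
  rw [pow_one, pow_one] at hb
  have hle : |(W.LFunction ℓ : ℝ)| ≤ 2 * Real.sqrt ℓ := by norm_num at hb ⊢; exact hb
  have hℓ1 : (1 : ℝ) ≤ ℓ := by exact_mod_cast hℓ.one_lt.le
  have hsq : Real.sqrt ℓ ≤ ℓ := by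
    calc Real.sqrt ℓ ≤ Real.sqrt ((ℓ : ℝ) ^ 2) := Real.sqrt_le_sqrt (by nlinarith)
      _ = ℓ := Real.sqrt_sq (by positivity)
  rw [Nat.cast_natAbs, Int.cast_abs]
  push_cast
  calc |(W.LFunction ℓ : ℝ) - (ℓ + 1)| ≤ |(W.LFunction ℓ : ℝ)| + |((ℓ : ℝ) + 1)| := abs_sub _ _
    _ ≤ 2 * Real.sqrt ℓ + (ℓ + 1) := by
        rw [abs_of_nonneg (by positivity : (0 : ℝ) ≤ (ℓ : ℝ) + 1)]; linarith
    _ ≤ 4 * ℓ := by nlinarith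

/-- `a_ℓ(W) ≠ ℓ + 1` for a prime `ℓ` (Hasse bound), in the form `|a_ℓ − (ℓ+1)| ≠ 0`. -/
theorem natAbs_lFunction_sub_ne_zero (W : WeierstrassCurve ℚ) [W.IsElliptic] {ℓ : ℕ}
    (hℓ : ℓ.Prime) : (W.LFunction ℓ - (ℓ + 1)).natAbs ≠ 0 := by
  rw [ne_eq, Int.natAbs_eq_zero, sub_eq_zero]
  exact W.lFunction_ne_prime_add_one hℓ

/-- L2 (PROVED, k3 g4): core divisibility ⟹ `v_p x ≤ v_p r + v_p |a_ℓ(W) − (ℓ+1)|` (`p ≥ 5`, `ℓ ∤ N⁺N⁻`). -/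
theorem factorization_le_of_core (S : XiSetup Nplus Nminus) [Fintype (ClassSet S.O)]
    [DecidableEq (ClassSet S.O)] (W : WeierstrassCurve ℚ) [W.IsElliptic]
    {φ : ClassSet S.O → ℤ} (hφ0 : φ ≠ 0)
    (hL : eigenLattice (Nplus * Nminus) (matrix S.O) (fun n => W.LFunction n) = ℤ ∙ φ)
    {x r : ℕ} (hr : r ≠ 0)
    (hcore : ∀ (i : ClassSet S.O) (y : ClassSet S.O → ℤ), ∑ c, y c = 0 →
      x ∣ (2 * (weight S.O i : ℤ) * φ i * ∑ c, (weight S.O c : ℤ) * φ c * y c).natAbs * r)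
    {p : ℕ} (hp : p.Prime) (h5 : 5 ≤ p) {ℓ : ℕ} (hℓ : ℓ.Prime) (hℓN : ¬ ℓ ∣ Nplus * Nminus) :
    x.factorization p ≤ r.factorization p + (W.LFunction ℓ - (ℓ + 1)).natAbs.factorization p := by
  have hpZ : Prime (p : ℤ) := Nat.prime_iff_prime_int.mp hp
  have hE0 : (W.LFunction ℓ - (ℓ + 1)).natAbs ≠ 0 := natAbs_lFunction_sub_ne_zero W hℓ
  have hne : ¬ (p : ℤ) ^ ((W.LFunction ℓ - (ℓ + 1)).natAbs.factorization p + 1) ∣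
      W.LFunction ℓ - (ℓ + 1) := by
    intro hd
    have hd' : p ^ ((W.LFunction ℓ - (ℓ + 1)).natAbs.factorization p + 1) ∣
        (W.LFunction ℓ - (ℓ + 1)).natAbs := Int.natCast_dvd.mp (by exact_mod_cast hd)
    exact Nat.pow_succ_factorization_not_dvd hE0 hp hd'
  obtain ⟨c₀, hc₀⟩ := exists_not_dvd_of_eigenLattice_eq_span hφ0 hL hp
  have hφL : φ ∈ eigenLattice (Nplus * Nminus) (matrix S.O) (fun n => W.LFunction n) :=
    hL ▸ Submodule.mem_span_singleton_self φ
  obtain ⟨c, d, hcd⟩ := XiSetup.exists_not_pow_dvd_weight_mul_sub S hφL hp h5 hc₀ hℓ hℓN hne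
  set δ : ℤ := (weight S.O c : ℤ) * φ c - (weight S.O d : ℤ) * φ d with hδ
  have hδ0 : δ ≠ 0 := by
    intro h; apply hcd; rw [h]; exact dvd_zero _
  have hδe : δ.natAbs.factorization p ≤ (W.LFunction ℓ - (ℓ + 1)).natAbs.factorization p := by
    by_contra hlt
    push Not at hlt
    apply hcd
    have h1 : p ^ ((W.LFunction ℓ - (ℓ + 1)).natAbs.factorization p + 1) ∣ δ.natAbs :=
      (hp.pow_dvd_iff_le_factorization (Int.natAbs_ne_zero.mpr hδ0)).mpr hlt
    exact_mod_cast Int.natCast_dvd.mpr h1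
  set y : ClassSet S.O → ℤ := Pi.single c 1 - Pi.single d 1 with hy
  have hy0 : ∑ i, y i = 0 := by
    simp only [hy, Pi.sub_apply, Pi.single_apply, Finset.sum_sub_distrib, Finset.sum_ite_eq',
      Finset.mem_univ, if_true, sub_self]
  have hpair : ∑ i, (weight S.O i : ℤ) * φ i * y i = δ := by
    simp only [hy, hδ, Pi.sub_apply, Pi.single_apply, mul_sub, mul_ite, mul_one, mul_zero,
      Finset.sum_sub_distrib, Finset.sum_ite_eq', Finset.mem_univ, if_true]
  have hdiv := hcore c₀ y hy0
  rw [hpair, Int.natAbs_mul, mul_assoc] at hdiv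
  have hA : ¬ p ∣ (2 * (weight S.O c₀ : ℤ) * φ c₀).natAbs := by
    intro hd
    have hd' : (p : ℤ) ∣ 2 * (weight S.O c₀ : ℤ) * φ c₀ := Int.natCast_dvd.mpr hd
    rcases hpZ.dvd_or_dvd hd' with h2 | h2
    · rcases hpZ.dvd_or_dvd h2 with h3 | h3
      · have h4 : p ∣ 2 := by exact_mod_cast h3
        have := Nat.le_of_dvd two_pos h4
        omega
      · exact S.not_dvd_weight c₀ hp h5 (Int.natCast_dvd_natCast.mp h3)
    · exact hc₀ h2
  have h1 : p ^ x.factorization p ∣ δ.natAbs * r :=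
    (Nat.Coprime.pow_left _ ((Nat.Prime.coprime_iff_not_dvd hp).mpr hA)).dvd_of_dvd_mul_left
      ((Nat.ordProj_dvd x p).trans hdiv)
  have hδr : δ.natAbs * r ≠ 0 := mul_ne_zero (Int.natAbs_ne_zero.mpr hδ0) hr
  have h2 := (hp.pow_dvd_iff_le_factorization hδr).mp h1
  rw [Nat.factorization_mul (Int.natAbs_ne_zero.mpr hδ0) hr, Finsupp.add_apply] at h2
  omega

/-! ## §1b  The small helpers of the tail (each ≤ one prover cycle) -/

/-- **L3 — the least good prime is `N^{o(1)}` (XS, PROVED; where `ε` is spent).**  Tree: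
`ModularForms.exists_prime_not_dvd_le_log` (Chebyshev: `ℓ ∤ N`, `ℓ ≤ 2 log N + C`), then
`log N ≤ N^ε/ε` (`Real.log_le_sub_one_of_pos` at `N^ε`). -/
theorem exists_prime_not_dvd_le_rpow {ε : ℝ} (hε : 0 < ε) :
    ∃ C : ℝ, 0 < C ∧ ∀ N : ℕ, 1 ≤ N → ∃ ℓ : ℕ, ℓ.Prime ∧ ¬ ℓ ∣ N ∧ (ℓ : ℝ) ≤ C * (N : ℝ) ^ ε := by
  obtain ⟨C, hC⟩ := exists_prime_not_dvd_le_log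
  refine ⟨2 / ε + max C 0, by positivity, fun N hN => ?_⟩
  obtain ⟨ℓ, hℓ, hℓN, hle⟩ := hC N (by omega)
  refine ⟨ℓ, hℓ, hℓN, hle.trans ?_⟩
  have hNpos : (0 : ℝ) < (N : ℝ) := by exact_mod_cast hN
  have hN1 : (1 : ℝ) ≤ (N : ℝ) := by exact_mod_cast hN
  have h1 : (1 : ℝ) ≤ (N : ℝ) ^ ε := Real.one_le_rpow hN1 hε.le
  have hlog : Real.log N ≤ (N : ℝ) ^ ε / ε := by
    have h2 : Real.log ((N : ℝ) ^ ε) ≤ (N : ℝ) ^ ε - 1 :=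
      Real.log_le_sub_one_of_pos (Real.rpow_pos_of_pos hNpos ε)
    rw [Real.log_rpow hNpos] at h2
    rw [le_div_iff₀ hε]
    linarith
  have hC0 : C ≤ max C 0 * (N : ℝ) ^ ε :=
    (le_max_left C 0).trans (le_mul_of_one_le_right (le_max_right _ _) h1)
  calc 2 * Real.log N + C ≤ 2 * ((N : ℝ) ^ ε / ε) + max C 0 * (N : ℝ) ^ ε :=
        add_le_add (mul_le_mul_of_nonneg_left hlog zero_le_two) hC0
    _ = (2 / ε + max C 0) * (N : ℝ) ^ ε := by ring

-- `2^{v₂ n} 3^{v₃ n} ∣ n` is the landed `Summit.ABC.ABC.Theorems.SteinbergCore.Negative.sixPart_dvd`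
-- (module not importable here: farm-stale); its one-line proof term is inlined at the two use sites below.

/-- The prime-to-`6` part `n / (2^{v₂ n} 3^{v₃ n})` of a non-zero natural number is non-zero. -/
theorem primeToSix_ne_zero {n : ℕ} (hn : n ≠ 0) : n / (ordProj[2] n * ordProj[3] n) ≠ 0 :=
  (Nat.div_pos (Nat.le_of_dvd (Nat.pos_of_ne_zero hn)
    (Nat.Coprime.mul_dvd_of_dvd_of_dvd (Nat.Coprime.pow _ _ (by norm_num : Nat.Coprime 2 3))
      (Nat.ordProj_dvd n 2) (Nat.ordProj_dvd n 3)))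
    (Nat.pos_of_ne_zero (mul_ne_zero (pow_ne_zero _ two_ne_zero) (pow_ne_zero _ three_ne_zero)))).ne'

/-- The valuations of `cps n = n / (2^{v₂ n} 3^{v₃ n})`: `0` at `2, 3`, those of `n` elsewhere
(self-contained; cf. `SteinbergCore.Negative.primeToSix_eq_ordCompl`). -/
theorem factorization_primeToSix (n q : ℕ) :
    (n / (ordProj[2] n * ordProj[3] n)).factorization q =
      if q = 2 ∨ q = 3 then 0 else n.factorization q := by
  rw [Nat.factorization_div
      (Nat.Coprime.mul_dvd_of_dvd_of_dvd (Nat.Coprime.pow _ _ (by norm_num : Nat.Coprime 2 3))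
      (Nat.ordProj_dvd n 2) (Nat.ordProj_dvd n 3)),
    Finsupp.tsub_apply,
    Nat.factorization_mul (pow_ne_zero _ two_ne_zero) (pow_ne_zero _ three_ne_zero),
    Finsupp.add_apply, Nat.prime_two.factorization_pow, Nat.prime_three.factorization_pow,
    Finsupp.single_apply, Finsupp.single_apply]
  by_cases h2 : q = 2
  · subst h2; simp
  · by_cases h3 : q = 3
    · subst h3; simp
    · simp [h2, h3, Ne.symm h2, Ne.symm h3]

/-- **L5 — `cps` bookkeeping (XS, PROVED, self-contained).**  `v_p x ≤ v_p r + v_p e` for all primes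
`p ≥ 5` (`r, e ≠ 0`) gives `cps x ∣ cps r · e`, hence `cps x ≤ cps r · e`. -/
theorem primeToSix_le_mul_of_factorization_le {x r e : ℕ} (hr : r ≠ 0) (he : e ≠ 0)
    (h : ∀ p : ℕ, p.Prime → 5 ≤ p → x.factorization p ≤ r.factorization p + e.factorization p) :
    x / (ordProj[2] x * ordProj[3] x) ≤ r / (ordProj[2] r * ordProj[3] r) * e := by
  rcases eq_or_ne x 0 with rfl | hx
  · simp
  have hcx := primeToSix_ne_zero hx
  have hcre : r / (ordProj[2] r * ordProj[3] r) * e ≠ 0 := mul_ne_zero (primeToSix_ne_zero hr) he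
  refine Nat.le_of_dvd (Nat.pos_of_ne_zero hcre) ((Nat.factorization_le_iff_dvd hcx hcre).mp ?_)
  rw [Nat.factorization_mul (primeToSix_ne_zero hr) he]
  refine Finsupp.le_def.mpr fun q => ?_
  rw [Finsupp.add_apply, factorization_primeToSix, factorization_primeToSix]
  by_cases h23 : q = 2 ∨ q = 3
  · simp [h23]
  · rw [if_neg h23, if_neg h23]
    by_cases hq : q.Prime
    · have h4 : q ≠ 4 := by rintro rfl; exact absurd hq (by decide)
      have h2q := hq.two_le
      push Not at h23
      exact h q hq (by omega)
    · simp [Nat.factorization_eq_zero_of_not_prime _ hq]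


/-! ### Statements used downstream (moved here unchanged from a later section of the source so that every new `def` lands in a round-1 module; docstrings verbatim) -/

/-! ## §1c  CHILD 1 IN CONGRUENCE CURRENCY — facts-free -/

/-- **`XiCongruenceComparison` (child 1♮, the facts-free re-cut of `stub_xiDegreeComparison`).**
For coprime `a, b` (`ab(a+b) ≠ 0`), `N = N(E_(a,b))`, admissible `Nm`, `ξ = ξ(E; N/Nm, Nm) ≠ 0` and EVERY
newform `f` of `E_(a,b)` at level `N`:  `cps ξ ≤ C_ε · N^ε · cps(r_f)`.
No datum, no minimality, no Tamagawa exponents, no ARS, no modularity (vacuous where no newform exists).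
[mechanism: theta-lattice congruence transfer, k1/k2/k3 gens 3–10] -/
def XiCongruenceComparison : Prop :=
  ∀ ε : ℝ, 0 < ε → ∃ C : ℝ, ∀ a b : ℤ, IsCoprime a b → a * b * (a + b) ≠ 0 → ∀ (N : ℕ) [NeZero N],
    (freyCurve a b).conductorNorm ℤ = N →
    ∀ Nm : ℕ, Odd Nm → Squarefree Nm → Odd Nm.primeFactors.card → Nm ∣ N →
    brandtXi (N / Nm) Nm (fun n => (freyCurve a b).LFunction n) ≠ 0 →
    ∀ f : CuspForm (Gamma0 N) 2, IsNewformOf (freyCurve a b) f →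
      ((brandtXi (N / Nm) Nm (fun n => (freyCurve a b).LFunction n) /
          (ordProj[2] (brandtXi (N / Nm) Nm (fun n => (freyCurve a b).LFunction n)) *
            ordProj[3] (brandtXi (N / Nm) Nm (fun n => (freyCurve a b).LFunction n))) : ℕ) : ℝ) ≤
        C * (N : ℝ) ^ ε *
          ((congruenceNumber f / (ordProj[2] (congruenceNumber f) * ordProj[3] (congruenceNumber f)) : ℕ) : ℝ)

end Summit.ABC.ABC.Theorems.SteinbergCoreXi.StubIdeasK1G11

end
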